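import Mathlib.Analysis.SpecialFunctions.Log.Basic
import Mathlib.Analysis.SpecialFunctions.Pow.Asymptotics
import Mathlib.Topology.Algebra.Order.Floor
import HarnessLib

/-!
# Removing the weight `log n`: from `Σ_{n ≤ N} b_n log n ∼ cN` to `Σ_{n ≤ N} b_n ∼ cN / log N`

Topic `Literature/NumberTheory/LFunctions`; namespace `Literature.NumberTheory.LFunctions.LogWeight`.
Pure-proof file (one theorem and its lemmas; no definition, no named fact).

**Theorem** (`tendsto_sum_mul_log_div`).  Let `b : ℕ → ℝ` be non-negative with `b 0 = b 1 = 0`, and put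
`Θ(N) = Σ_{1 ≤ n ≤ N} log n · b n`, `Π(N) = Σ_{1 ≤ n ≤ N} b n`.  If `Θ(N)/N → c` then
`Π(N) · log N / N → c`.

This is the elementary passage "`θ(x) ∼ x ⇒ π(x) ∼ x/log x`" of the prime number theorem
(Chebyshev; Hardy–Wright Thm. 420; Montgomery–Vaughan §2.2 p. 49 / Cor. 8.8 ⇒ (8.29)), written for an
arbitrary non-negative weight so that it applies verbatim to the counting functions of SETS of prime
ideals of a number field (`b n = #{𝔭 ∈ X : N𝔭 = n}`), where the Tauberian theorems produce the
log-weighted count `Θ` and densities are stated for the plain count `Π`.  Proof (the classical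
sandwich): `Θ(N) ≤ Π(N) log N`, and for `1 ≤ M ≤ N`,
`Π(N) ≤ Θ(M)/log 2 + Θ(N)/log(M+1)`; with `M = ⌊N/log² N⌋`:
`Π(N) log N/N ≤ (Θ(M)/M)/(log 2 · log N) + (Θ(N)/N) · log N/log(M+1)` and `log(M+1)/log N → 1`.

## References

* H. L. Montgomery, R. C. Vaughan, *Multiplicative Number Theory I*, CUP 2007, §2.2 (partial summation
  between `θ` and `π`), §8.3 (8.29). [MontgomeryVaughan2007]
* G. H. Hardy, E. M. Wright, *An Introduction to the Theory of Numbers*, Thm. 420. [folklore]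

## Mathlib / tree search

Mathlib: `Chebyshev.primeCounting_eq_theta_div_log_add_integral` (the exact Abel-summation identity for the
rational primes only); `Real.isLittleO_pow_log_id_atTop`, `Real.isLittleO_log_id_atTop`,
`tendsto_nat_floor_atTop`.  Tree: `PrimeIdealChebyshev.primeIdealCount_eq_theta_div_log_add_integral` (all
prime ideals, with error terms), `PrimeCountingThetaRatio` (rational primes).  `lean search
'sum_mul_log_div|log_weight|LogWeight'`: nothing generic.
-/

noncomputable section

open Filter Finset Real Asymptotics

open scoped _root_.Topology

namespace Literature.NumberTheory.LFunctions

namespace LogWeight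

variable {b : ℕ → ℝ}

/-! ### The two elementary inequalities -/

/-- `Θ(N) ≤ log N · Π(N)`: `log n ≤ log N` for `1 ≤ n ≤ N`. [folklore] -/
theorem sum_log_mul_le_log_mul_sum (hb : ∀ n, 0 ≤ b n) (N : ℕ) :
    ∑ n ∈ Icc 1 N, Real.log n * b n ≤ Real.log N * ∑ n ∈ Icc 1 N, b n := by
  rw [mul_sum]
  refine sum_le_sum fun n hn => ?_
  rw [mem_Icc] at hn
  refine mul_le_mul_of_nonneg_right (Real.log_le_log (by exact_mod_cast hn.1) (by exact_mod_cast hn.2)) (hb n)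

/-- On a block `M < n ≤ N`: `Σ b n ≤ (Σ log n · b n) / log(M+1)`. [folklore] -/
theorem sum_Ioc_le_div_log (hb : ∀ n, 0 ≤ b n) {M N : ℕ} (hM : 1 ≤ M) :
    ∑ n ∈ Ioc M N, b n ≤ (∑ n ∈ Ioc M N, Real.log n * b n) / Real.log (M + 1) := by
  have hlog : 0 < Real.log ((M : ℝ) + 1) := Real.log_pos (by
    have : (1 : ℝ) ≤ M := by exact_mod_cast hM
    linarith)
  rw [le_div_iff₀ hlog, sum_mul]
  refine sum_le_sum fun n hn => ?_
  rw [mem_Ioc] at hn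
  have h1 : Real.log ((M : ℝ) + 1) ≤ Real.log n :=
    Real.log_le_log (by positivity) (by exact_mod_cast hn.1)
  calc b n * Real.log ((M : ℝ) + 1) ≤ b n * Real.log n := mul_le_mul_of_nonneg_left h1 (hb n)
    _ = Real.log n * b n := mul_comm _ _

/-- `Π(M) ≤ Θ(M)/log 2` when `b 1 = 0` (all other terms have `log n ≥ log 2`). [folklore] -/
theorem sum_le_div_log_two (hb : ∀ n, 0 ≤ b n) (hb1 : b 1 = 0) (M : ℕ) :
    ∑ n ∈ Icc 1 M, b n ≤ (∑ n ∈ Icc 1 M, Real.log n * b n) / Real.log 2 := by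
  have hlog : 0 < Real.log 2 := Real.log_pos (by norm_num)
  rw [le_div_iff₀ hlog, sum_mul]
  refine sum_le_sum fun n hn => ?_
  rw [mem_Icc] at hn
  rcases eq_or_lt_of_le hn.1 with h | h
  · rw [← h, hb1]; simp
  · have h2 : (2 : ℝ) ≤ n := by exact_mod_cast h
    calc b n * Real.log 2 ≤ b n * Real.log n :=
          mul_le_mul_of_nonneg_left (Real.log_le_log (by norm_num) h2) (hb n)
      _ = Real.log n * b n := mul_comm _ _

/-- The sandwich upper bound: for `1 ≤ M ≤ N`,
`Π(N) ≤ Θ(M)/log 2 + Θ(N)/log(M+1)`. [folklore] -/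
theorem sum_le_of_split (hb : ∀ n, 0 ≤ b n) (hb1 : b 1 = 0) {M N : ℕ} (hM : 1 ≤ M) (hMN : M ≤ N) :
    ∑ n ∈ Icc 1 N, b n ≤
      (∑ n ∈ Icc 1 M, Real.log n * b n) / Real.log 2 +
        (∑ n ∈ Icc 1 N, Real.log n * b n) / Real.log (M + 1) := by
  have hsplit : ∀ g : ℕ → ℝ, ∑ n ∈ Icc 1 N, g n = ∑ n ∈ Icc 1 M, g n + ∑ n ∈ Ioc M N, g n := by
    intro g
    have hdisj : Disjoint (Icc 1 M) (Ioc M N) := by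
      rw [disjoint_left]
      intro n h1 h2
      rw [mem_Icc] at h1; rw [mem_Ioc] at h2
      omega
    have hunion : Icc 1 N = Icc 1 M ∪ Ioc M N := by
      ext n
      simp only [mem_union, mem_Icc, mem_Ioc]
      omega
    rw [hunion, sum_union hdisj]
  have hlog : 0 < Real.log ((M : ℝ) + 1) := Real.log_pos (by
    have : (1 : ℝ) ≤ M := by exact_mod_cast hM
    linarith)
  have hΘM : 0 ≤ ∑ n ∈ Icc 1 M, Real.log n * b n :=
    sum_nonneg fun n hn => mul_nonneg (Real.log_nonneg (by
      rw [mem_Icc] at hn; exact_mod_cast hn.1)) (hb n)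
  rw [hsplit b]
  refine add_le_add (sum_le_div_log_two hb hb1 M) ?_
  refine (sum_Ioc_le_div_log hb (N := N) hM).trans ?_
  rw [hsplit (fun n => Real.log n * b n), add_div]
  linarith [div_nonneg hΘM hlog.le]

/-! ### Asymptotics of the cut point `M = ⌊N / log² N⌋` -/

/-- `log(log x)/log x → 0`. [folklore] -/
theorem tendsto_log_log_div_log :
    Tendsto (fun x : ℝ => Real.log (Real.log x) / Real.log x) atTop (𝓝 0) := by
  have h := Real.isLittleO_log_id_atTop.comp_tendsto Real.tendsto_log_atTop
  simpa [Function.comp_def] using h.tendsto_div_nhds_zero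

/-- **`log(⌊N/log² N⌋ + 1) / log N → 1`** along the natural numbers. [folklore] -/
theorem tendsto_log_floor_add_one_div_log :
    Tendsto (fun N : ℕ => Real.log ((⌊(N : ℝ) / Real.log N ^ 2⌋₊ : ℝ) + 1) / Real.log N) atTop (𝓝 1) := by
  -- lower bound `1 - 2 log log N / log N → 1`, upper bound `1`
  have hlow : Tendsto (fun N : ℕ => 1 - 2 * (Real.log (Real.log N) / Real.log N)) atTop (𝓝 1) := by
    have h := (tendsto_log_log_div_log.comp tendsto_natCast_atTop_atTop).const_mul 2
    have h2 := h.const_sub 1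
    simpa using h2
  refine tendsto_of_tendsto_of_tendsto_of_le_of_le' hlow tendsto_const_nhds ?_ ?_
  · -- `1 - 2 log log N / log N ≤ log(M+1)/log N`
    filter_upwards [eventually_gt_atTop 3, (tendsto_natCast_atTop_atTop (R := ℝ)).eventually
      (eventually_gt_atTop (Real.exp 1))] with N hN hNe
    have hN1 : (1 : ℝ) < N := by exact_mod_cast (show 1 < N by omega)
    have hlogN : 0 < Real.log N := Real.log_pos hN1
    have hlog1 : 1 < Real.log N := by
      rw [Real.lt_log_iff_exp_lt (by linarith)]; exact hNe
    have hy : 0 < (N : ℝ) / Real.log N ^ 2 := div_pos (by linarith) (by positivity)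
    have hfloor : (N : ℝ) / Real.log N ^ 2 < (⌊(N : ℝ) / Real.log N ^ 2⌋₊ : ℝ) + 1 := Nat.lt_floor_add_one _
    have h1 : Real.log ((N : ℝ) / Real.log N ^ 2) ≤ Real.log ((⌊(N : ℝ) / Real.log N ^ 2⌋₊ : ℝ) + 1) :=
      Real.log_le_log hy hfloor.le
    have h2 : Real.log ((N : ℝ) / Real.log N ^ 2) = Real.log N - 2 * Real.log (Real.log N) := by
      rw [Real.log_div (by linarith) (by positivity), Real.log_pow]; ring
    have : 1 - 2 * (Real.log (Real.log N) / Real.log N) = (Real.log N - 2 * Real.log (Real.log N)) / Real.log N := by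
      field_simp
    rw [this, div_le_div_iff_of_pos_right hlogN, ← h2]
    exact h1
  · -- `log(M+1) ≤ log N`
    filter_upwards [eventually_gt_atTop 3, (tendsto_natCast_atTop_atTop (R := ℝ)).eventually
      (eventually_gt_atTop (Real.exp 2))] with N hN hNe
    have hN1 : (1 : ℝ) < N := by exact_mod_cast (show 1 < N by omega)
    have hlogN : 0 < Real.log N := Real.log_pos hN1
    have hlog2 : 2 < Real.log N := by
      rw [Real.lt_log_iff_exp_lt (by linarith)]; exact hNe
    rw [div_le_one hlogN]
    refine Real.log_le_log (by positivity) ?_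
    have hsq : 4 < Real.log N ^ 2 := by nlinarith
    have hle : (⌊(N : ℝ) / Real.log N ^ 2⌋₊ : ℝ) ≤ (N : ℝ) / Real.log N ^ 2 := Nat.floor_le (by positivity)
    have hdiv : (N : ℝ) / Real.log N ^ 2 ≤ N / 4 :=
      div_le_div_of_nonneg_left (by positivity) (by norm_num) hsq.le
    have hN4 : (4 : ℝ) ≤ N := by exact_mod_cast (show 4 ≤ N by omega)
    linarith

/-- The cut point tends to infinity: `⌊N/log² N⌋ → ∞` (since `x/log² x → ∞`; cf. the tree's
`tendsto_self_div_log_sq_atTop` in `MidpointSieveGain.lean`, not imported here to keep this file light).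
[folklore] -/
theorem tendsto_floor_div_log_sq_atTop :
    Tendsto (fun N : ℕ => ⌊(N : ℝ) / Real.log N ^ 2⌋₊) atTop atTop := by
  have hreal : Tendsto (fun x : ℝ => x / Real.log x ^ 2) atTop atTop := by
    have h1 : (fun x : ℝ => Real.log x ^ 2) =o[atTop] id := Real.isLittleO_pow_log_id_atTop
    have h2 : Tendsto (fun x : ℝ => Real.log x ^ 2 / x) atTop (𝓝 0) := by
      simpa using h1.tendsto_div_nhds_zero
    have h3 : ∀ᶠ x : ℝ in atTop, 0 < Real.log x ^ 2 / x := by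
      filter_upwards [eventually_gt_atTop (1 : ℝ)] with x hx
      exact div_pos (pow_pos (Real.log_pos hx) 2) (by linarith)
    have h3' : Tendsto (fun x : ℝ => Real.log x ^ 2 / x) atTop (𝓝[>] 0) :=
      tendsto_nhdsWithin_iff.mpr ⟨h2, h3⟩
    refine h3'.inv_tendsto_nhdsGT_zero.congr' ?_
    filter_upwards [eventually_gt_atTop (0 : ℝ)] with x hx
    simp only [Pi.inv_apply]
    rw [inv_div]
  exact tendsto_nat_floor_atTop.comp (hreal.comp tendsto_natCast_atTop_atTop)

/-! ### The theorem -/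

/-- **Removing the logarithmic weight.**  Let `b ≥ 0` with `b 0 = b 1 = 0` and suppose
`(Σ_{1 ≤ n ≤ N} log n · b n)/N → c`.  Then `(Σ_{1 ≤ n ≤ N} b n) · log N / N → c`.
(The passage `θ ∼ x ⇒ π ∼ x/log x`; here for an arbitrary non-negative weight, to be applied to the
norm-counting functions of sets of prime ideals.) [cite: MontgomeryVaughan2007, §2.2 and §8.3 (8.29)] -/
theorem tendsto_sum_mul_log_div (hb : ∀ n, 0 ≤ b n) (hb1 : b 1 = 0) {c : ℝ}
    (hΘ : Tendsto (fun N : ℕ => (∑ n ∈ Icc 1 N, Real.log n * b n) / N) atTop (𝓝 c)) :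
    Tendsto (fun N : ℕ => (∑ n ∈ Icc 1 N, b n) * Real.log N / N) atTop (𝓝 c) := by
  -- notation
  set Θ : ℕ → ℝ := fun N => ∑ n ∈ Icc 1 N, Real.log n * b n with hΘdef
  set P : ℕ → ℝ := fun N => ∑ n ∈ Icc 1 N, b n with hPdef
  set M : ℕ → ℕ := fun N => ⌊(N : ℝ) / Real.log N ^ 2⌋₊ with hMdef
  have hΘnn : ∀ N, 0 ≤ Θ N := fun N => sum_nonneg fun n hn => mul_nonneg (Real.log_nonneg (by
      rw [mem_Icc] at hn; exact_mod_cast hn.1)) (hb n)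
  have hPnn : ∀ N, 0 ≤ P N := fun N => sum_nonneg fun n _ => hb n
  have hc : 0 ≤ c :=
    ge_of_tendsto' hΘ fun N => div_nonneg (hΘnn N) (Nat.cast_nonneg N)
  have hM := tendsto_floor_div_log_sq_atTop
  -- `Θ(M_N)/M_N → c`
  have hΘM : Tendsto (fun N : ℕ => Θ (M N) / (M N : ℝ)) atTop (𝓝 c) := hΘ.comp hM
  -- `1/(log 2 · log N) → 0`
  have hinvlog : Tendsto (fun N : ℕ => 1 / (Real.log 2 * Real.log N)) atTop (𝓝 0) := by
    have h := (Real.tendsto_log_atTop.comp tendsto_natCast_atTop_atTop).const_mul_atTop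
      (Real.log_pos (by norm_num : (1:ℝ) < 2))
    convert h.inv_tendsto_atTop using 1
    ext N
    simp [one_div]
  -- `log N / log(M_N + 1) → 1`
  have hratio : Tendsto (fun N : ℕ => Real.log N / Real.log ((M N : ℝ) + 1)) atTop (𝓝 1) := by
    have h := tendsto_log_floor_add_one_div_log.inv₀ one_ne_zero
    rw [inv_one] at h
    convert h using 1
    ext N
    simp [inv_div, hMdef]
  -- upper function
  have hU : Tendsto (fun N : ℕ => Θ (M N) / (M N : ℝ) * (1 / (Real.log 2 * Real.log N)) +
      Θ N / N * (Real.log N / Real.log ((M N : ℝ) + 1))) atTop (𝓝 c) := by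
    have h := (hΘM.mul hinvlog).add (hΘ.mul hratio)
    simpa using h
  refine tendsto_of_tendsto_of_tendsto_of_le_of_le' hΘ hU ?_ ?_
  · -- lower bound `Θ N / N ≤ P N log N / N`
    filter_upwards [eventually_ge_atTop 1] with N hN
    have hN : (0 : ℝ) < N := by exact_mod_cast hN
    rw [div_le_div_iff_of_pos_right hN, mul_comm]
    exact sum_log_mul_le_log_mul_sum hb N
  · -- upper bound, for `N` large (`1 ≤ M_N ≤ N`)
    filter_upwards [hM.eventually (eventually_ge_atTop 1), eventually_gt_atTop 3,
      (tendsto_natCast_atTop_atTop (R := ℝ)).eventually (eventually_gt_atTop (Real.exp 2))]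
      with N hM1 hN3 hNe
    have hN1 : (1 : ℝ) < N := by exact_mod_cast (show 1 < N by omega)
    have hN0 : (0 : ℝ) < N := by linarith
    have hlogN : 0 < Real.log N := Real.log_pos hN1
    have hlog2 : 2 < Real.log N := by
      rw [Real.lt_log_iff_exp_lt (by linarith)]; exact hNe
    have hlogM : 0 < Real.log ((M N : ℝ) + 1) := Real.log_pos (by
      have : (1 : ℝ) ≤ M N := by exact_mod_cast hM1
      linarith)
    have hMpos : (0 : ℝ) < M N := by exact_mod_cast hM1
    have hMle : (M N : ℝ) ≤ (N : ℝ) / Real.log N ^ 2 := Nat.floor_le (by positivity)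
    have hMN : M N ≤ N := by
      have h1 : (N : ℝ) / Real.log N ^ 2 ≤ N := by
        rw [div_le_iff₀ (by positivity)]
        have hsq : (1 : ℝ) ≤ Real.log N ^ 2 := by nlinarith
        calc (N : ℝ) = N * 1 := (mul_one _).symm
          _ ≤ N * Real.log N ^ 2 := mul_le_mul_of_nonneg_left hsq hN0.le
      exact_mod_cast hMle.trans h1
    have hsplit := sum_le_of_split hb hb1 hM1 hMN
    -- `P N log N / N ≤ Θ(M)/log 2 · log N/N + Θ N/ log(M+1) · log N / N`
    have step1 : P N * Real.log N / N ≤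
        (Θ (M N) / Real.log 2 + Θ N / Real.log ((M N : ℝ) + 1)) * Real.log N / N := by
      rw [div_le_div_iff_of_pos_right hN0]
      exact mul_le_mul_of_nonneg_right hsplit hlogN.le
    refine step1.trans ?_
    -- compare termwise
    have hlog2pos : 0 < Real.log 2 := Real.log_pos (by norm_num)
    have t1 : Θ (M N) / Real.log 2 * Real.log N / N ≤
        Θ (M N) / (M N : ℝ) * (1 / (Real.log 2 * Real.log N)) := by
      -- uses `M ≤ N / log² N`, i.e. `M log² N ≤ N`
      have hkey : (M N : ℝ) * Real.log N ^ 2 ≤ N := by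
        rwa [le_div_iff₀ (by positivity)] at hMle
      rw [div_mul_eq_mul_div, div_div, div_le_iff₀ (by positivity)]
      calc Θ (M N) * Real.log N
          = Θ (M N) / (M N : ℝ) * (1 / (Real.log 2 * Real.log N)) * (Real.log 2 * ((M N : ℝ) * Real.log N ^ 2)) := by
            field_simp
        _ ≤ Θ (M N) / (M N : ℝ) * (1 / (Real.log 2 * Real.log N)) * (Real.log 2 * N) := by
            refine mul_le_mul_of_nonneg_left (mul_le_mul_of_nonneg_left hkey hlog2pos.le) ?_
            exact mul_nonneg (div_nonneg (hΘnn _) hMpos.le) (by positivity)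
    have t2 : Θ N / Real.log ((M N : ℝ) + 1) * Real.log N / N =
        Θ N / N * (Real.log N / Real.log ((M N : ℝ) + 1)) := by
      field_simp
    calc (Θ (M N) / Real.log 2 + Θ N / Real.log ((M N : ℝ) + 1)) * Real.log N / N
        = Θ (M N) / Real.log 2 * Real.log N / N + Θ N / Real.log ((M N : ℝ) + 1) * Real.log N / N := by
          ring
      _ ≤ Θ (M N) / (M N : ℝ) * (1 / (Real.log 2 * Real.log N)) +
          Θ N / N * (Real.log N / Real.log ((M N : ℝ) + 1)) := by
          rw [t2]; exact add_le_add t1 le_rfl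

end LogWeight

end Literature.NumberTheory.LFunctions

end
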